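import Summits.BirchSwinnertonDyer.BirchSwinnertonDyer.Theorems.ResidualThetaTransportAtTwoResidualSignedLambdaLowerCMAtTwoLocalBlockCountCofree
import Literature.NumberTheory.EllipticCurves.ZpCorankQuasiIso
import Literature.NumberTheory.GaloisRepresentations.DecompositionGroupOfCompletion
import HarnessLib

/-!
# The GOOD-PLACE LOCAL BLOCK of RSL_g's one-pair count, in RSL_g's own currency: from `ρ.IsUnramifiedAt v ∧ ρ.HasFrobCharpolyAt v (X² − aX + q)`
# to `#H¹(ℚ_{∞,w}, A_ρ)[2^k] = #A_ρ[2^k]` (‖a‖ < 1) / `H¹(ℚ_{∞,w}, A_ρ) = 0` (‖a‖ = 1), and `corank_{ℤ₂} = f · (if ‖a‖ < 1 then 2 else 0)`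

Route `ResidualThetaTransportAtTwo` (RTT), crux RSL_g `ResidualSignedLambdaLowerCMAtTwo` (stmt-BirchSwinnertonDyer-22608); width seat
`prover-bsd-wall-tp2-p2x-w3` g16 (`--supports 22608 --as helper`, closes nothing). THEOREMS ONLY (no definition, no named fact, no instance, no notation,
no `sorry`). Third file of the local-block chain (`…LocalBlockCount.lean` abstract GV Prop. (2.4) corank form; `…LocalBlockCountCofree.lean` the
cofree module in matrix currency). Stub plan rev 20 §3 item 5 (split stub S1⊕ `stub_localDualAwayTwo`): the habitat clause of RSL_g at a good place
`v ∤ 2M` reads `ρ.IsUnramifiedAt v ∧ ∃ P, P.map 𝒪.subtype = X² − C (ι a_ℓ) X + C ℓ ∧ ρ.HasFrobCharpolyAt v P`, and RSL_g's summand there is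
`2^{n_ℓ} · (if ‖ι a_ℓ‖ < 1 then 2 else 0)`.

* §4 `apply_absGaloisRestrict_eq_one_of_isUnramifiedAt` (local inertia ↦ `1`, `inertia_adicCompletionPrime_eq_map_absInertia`),
  `charpoly_apply_absGaloisRestrict_eq` (a local Frobenius `φ`, `IsFrobPow φ 1`, has `charpoly ρ(res_v φ) = P`:
  `isFrobPow_one_iff_isAbsArithFrob` + `isArithFrobAt_absGaloisRestrict_adicCompletionPrime_iff`), `trace_det_of_charpoly_map_eq` (`Matrix.charpoly_fin_two`),
  **`det_sub_one_mem_and_trace_mem_iff`**: `det ρ(res_v φ) − 1 ∈ (ϖ)` (`q` odd) and `tr ρ(res_v φ) ∈ (ϖ) ↔ ‖a‖ < 1` (`𝒪`: norm `< 1` ⟺ in `(ϖ)`);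
  hence **`natCard_torsionBy_subgroupH1_cofree_eq_of_norm_lt_one`** and **`subgroupH1_cofree_eq_zero_of_not_norm_lt_one`**.
* §5 `natCard_torsionBy_eq_pow_zpCorank_of_divisible'` (`#A[p] = p^{corank}` for `p`-divisible `A`, from the tree's `pow_zpCorank_mul_natCard_modN`) and
  **`zpCorank_subgroupH1_cofree_eq : corank_{ℤ₂} H¹(Hi, A_ρ) = f · (if ‖a‖ < 1 then 2 else 0)`** along RSL_g's basis pin `B : ℤ₂^f ≃+ 𝒪`
  (`natCard_quotient_span_natCast_of_addEquiv`, `natCard_padicInt_quotient_span`) — the per-block value of the `S₀`-count `f·Σ ≤ λ_{ℤ₂}(P_{S₀})`;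
  `λ_{ℤ₂}` of a Pontryagin dual equals the corank by the tree's `finrank_eq_zpCorank_of_addEquiv_characterModule`. The `2^{n_ℓ}` conjugate blocks
  and the value pins are the split frame's.

BSD is not proved by any of this; RSL_g (22608) is not proved here.
References: [GreenbergVatsal2000] §1 p. 7, §2 Prop. (2.4); [SerreAbelianLadic1968] Ch. I §2.1; [NeukirchANT1999] Ch. II (4.8), §9 Prop. (9.6);
[Greenberg1999] §1; [TateCorvallis1979] (1.4.1).
-/

set_option autoImplicit false
-- the Theorems namespace of this sub repeats the summit name by design (D-0017 nested layout)
set_option linter.dupNamespace false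

noncomputable section

open scoped Classical

namespace Summit.BirchSwinnertonDyer.BirchSwinnertonDyer.Theorems.ThetaTransport.LocalBlockCount

open NumberField IsDedekindDomain Field
open Literature.NumberTheory.EllipticCurves Literature.NumberTheory.GaloisRepresentations
  Literature.NumberTheory.GaloisRepresentations.IsNonarchimedeanLocalField
  Literature.NumberTheory.EllipticCurves.GreenbergSelmer IsDedekindDomain.HeightOneSpectrum

/-! ## §4 RSL_g currency: the matrix hypotheses from `ρ.IsUnramifiedAt v` and `ρ.HasFrobCharpolyAt v P`, `P ↦ X² − aX + q` in `ℚ̄₂[X]` -/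

section Frobenius

variable (S : Set (PadicAlgCl 2)) [FiniteDimensional ℚ_[2] (padicCoeffField S)]
  (ρ : FramedGaloisRep ℚ (padicCoeffIntegers S) 2) (κ : ZpExtension ℚ 2) {v : HeightOneSpectrum (𝓞 ℚ)}

omit [FiniteDimensional ℚ_[2] (padicCoeffField S)] in
/-- An element of `𝒪 = padicCoeffIntegers S` of norm `1` is a unit (its inverse in `ℚ̄₂` lies in `ℚ₂(S)` and has norm `1`). [cite: NeukirchANT1999, Ch. II (4.8)] -/
theorem isUnit_of_norm_coe_eq_one {u : padicCoeffIntegers S} (hu : ‖(u : PadicAlgCl 2)‖ = 1) : IsUnit u := by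
  have hne : (u : PadicAlgCl 2) ≠ 0 := fun h0 ↦ by rw [h0, norm_zero] at hu; exact zero_ne_one hu
  refine isUnit_iff_exists_inv.mpr ⟨⟨(u : PadicAlgCl 2)⁻¹, inv_mem u.2.1, by rw [norm_inv, hu, inv_one]⟩, Subtype.ext ?_⟩
  change (u : PadicAlgCl 2) * (u : PadicAlgCl 2)⁻¹ = 1
  exact mul_inv_cancel₀ hne

omit [FiniteDimensional ℚ_[2] (padicCoeffField S)] in
/-- **An element of `(ϖ)` has norm `< 1`** (`ϖ` irreducible is a non-unit, so `‖ϖ‖ < 1`; `‖yϖ‖ ≤ ‖ϖ‖`). Converse of the tree's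
`ThetaTransport.mem_span_of_norm_lt_one`. [cite: NeukirchANT1999, Ch. II (4.8)] -/
theorem norm_coe_lt_one_of_mem_span {ϖ : padicCoeffIntegers S} (hϖ : Irreducible ϖ) {x : padicCoeffIntegers S}
    (hx : x ∈ Ideal.span {ϖ}) : ‖(x : PadicAlgCl 2)‖ < 1 := by
  obtain ⟨y, rfl⟩ := Ideal.mem_span_singleton'.mp hx
  have hϖ1 : ‖(ϖ : PadicAlgCl 2)‖ < 1 :=
    lt_of_le_of_ne ϖ.2.2 fun h ↦ hϖ.not_isUnit (isUnit_of_norm_coe_eq_one S h)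
  rw [Subring.coe_mul, norm_mul]
  exact mul_lt_one_of_nonneg_of_lt_one_right y.2.2 (norm_nonneg _) hϖ1

omit [FiniteDimensional ℚ_[2] (padicCoeffField S)] in
/-- A unit of `𝒪` has norm `1` (both `u` and `u⁻¹` lie in the unit ball). (Same statement as the tree's
`ThetaTransport.norm_coe_eq_one_of_isUnit`, restated here to keep this file's imports local.) [cite: NeukirchANT1999, Ch. II (4.8)] -/
private theorem norm_coe_eq_one_of_isUnit' {u : padicCoeffIntegers S} (hu : IsUnit u) : ‖(u : PadicAlgCl 2)‖ = 1 := by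
  obtain ⟨w, hw⟩ := isUnit_iff_exists_inv.mp hu
  have h1 : ‖(u : PadicAlgCl 2)‖ * ‖(w : PadicAlgCl 2)‖ = 1 := by
    rw [← norm_mul, ← Subring.coe_mul, hw, OneMemClass.coe_one, norm_one]
  refine le_antisymm u.2.2 (not_lt.mp fun hlt ↦ ?_)
  have := mul_lt_one_of_nonneg_of_lt_one_left (norm_nonneg _) hlt w.2.2
  linarith

/-- **An element of norm `< 1` lies in `(ϖ)`** (a non-unit of the DVR `𝒪`, whose maximal ideal is `(ϖ)`). (Same statement as the tree's
`ThetaTransport.mem_span_of_norm_lt_one`, restated to keep imports local.) [cite: NeukirchANT1999, Ch. II (4.8)] -/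
private theorem mem_span_of_norm_lt_one' {ϖ : padicCoeffIntegers S} (hϖ : Irreducible ϖ) {x : padicCoeffIntegers S}
    (hx : ‖(x : PadicAlgCl 2)‖ < 1) : x ∈ Ideal.span {ϖ} := by
  haveI : IsDiscreteValuationRing (padicCoeffIntegers S) :=
    Summit.BirchSwinnertonDyer.BirchSwinnertonDyer.Theorems.PollackPairK.isDiscreteValuationRing_padicCoeffIntegers (S := S)
  rw [← (IsDiscreteValuationRing.irreducible_iff_uniformizer ϖ).mp hϖ, IsLocalRing.mem_maximalIdeal, mem_nonunits_iff]
  intro hu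
  have := norm_coe_eq_one_of_isUnit' S hu
  linarith

omit [FiniteDimensional ℚ_[2] (padicCoeffField S)] in
/-- **Local inertia acts trivially through an unramified `ρ`**: `ρ(res_v σ) = 1` for `σ ∈ I_{ℚ_v}` when `ρ.IsUnramifiedAt v` (the prime above `v` cut out
by the chosen embedding has inertia group `res_v(I_{ℚ_v})`, `inertia_adicCompletionPrime_eq_map_absInertia`). [cite: NeukirchANT1999, Ch. II §9 Prop. (9.6)] -/
theorem apply_absGaloisRestrict_eq_one_of_isUnramifiedAt (hur : FramedGaloisRep.IsUnramifiedAt v ρ) {σ : absoluteGaloisGroup (v.adicCompletion ℚ)}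
    (hσ : σ ∈ absInertia (v.adicCompletion ℚ)) : ρ (absGaloisRestrict ℚ (v.adicCompletion ℚ) σ) = 1 :=
  hur _ (adicCompletionPrime_mem_primesAbove ℚ v) _ (by
    rw [inertia_adicCompletionPrime_eq_map_absInertia]
    exact Subgroup.mem_map_of_mem _ hσ)

omit [FiniteDimensional ℚ_[2] (padicCoeffField S)] in
/-- **A local Frobenius has the global Frobenius characteristic polynomial**: for `φ ∈ Γ_{ℚ_v}` with `IsFrobPow φ 1` (an absolute arithmetic
Frobenius, `isFrobPow_one_iff_isAbsArithFrob`) and `ρ.HasFrobCharpolyAt v P`: `charpoly ρ(res_v φ) = P` (`res_v φ` is an arithmetic Frobenius at the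
prime `adicCompletionPrime ℚ v`). [cite: SerreAbelianLadic1968, Ch. I §2.1] -/
theorem charpoly_apply_absGaloisRestrict_eq {P : Polynomial (padicCoeffIntegers S)} (hP : FramedGaloisRep.HasFrobCharpolyAt v P ρ)
    {φ : absoluteGaloisGroup (v.adicCompletion ℚ)} (hφ : IsFrobPow φ 1) :
    FramedRep.charpoly ρ (absGaloisRestrict ℚ (v.adicCompletion ℚ) φ) = P := by
  have hq : residueFieldCard (v.adicCompletion ℚ) = Nat.card (𝓞 ℚ ⧸ v.asIdeal) := by
    rw [Literature.NumberTheory.Automorphic.residueFieldCard_adicCompletion_eq, HeightOneSpectrum.residueCard_eq_card_quotient]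
  exact hP _ (adicCompletionPrime_mem_primesAbove ℚ v) _
    ((isArithFrobAt_absGaloisRestrict_adicCompletionPrime_iff ℚ v hq φ).2 (isFrobPow_one_iff_isAbsArithFrob_holds.mp hφ))

omit [FiniteDimensional ℚ_[2] (padicCoeffField S)] in
/-- Reading trace and determinant off a `2 × 2` characteristic polynomial mapped into `ℚ̄₂`: if `charpoly M ↦ X² − aX + b` under `𝒪 ↪ ℚ̄₂`
then `tr M ↦ a` and `det M ↦ b` (`Matrix.charpoly_fin_two`). [folklore] -/
theorem trace_det_of_charpoly_map_eq (M : Matrix (Fin 2) (Fin 2) (padicCoeffIntegers S)) {a b : PadicAlgCl 2}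
    (h : M.charpoly.map (padicCoeffIntegers S).subtype = Polynomial.X ^ 2 - Polynomial.C a * Polynomial.X + Polynomial.C b) :
    ((M.trace : padicCoeffIntegers S) : PadicAlgCl 2) = a ∧ ((M.det : padicCoeffIntegers S) : PadicAlgCl 2) = b := by
  rw [Matrix.charpoly_fin_two, Polynomial.map_add, Polynomial.map_sub, Polynomial.map_pow, Polynomial.map_mul, Polynomial.map_X,
    Polynomial.map_C, Polynomial.map_C] at h
  have h1 := congrArg (fun Q : Polynomial (PadicAlgCl 2) ↦ Q.coeff 1) h
  have h0 := congrArg (fun Q : Polynomial (PadicAlgCl 2) ↦ Q.coeff 0) h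
  simp only [Polynomial.coeff_add, Polynomial.coeff_sub, Polynomial.coeff_X_pow, Polynomial.coeff_C_mul, Polynomial.coeff_X_one,
    Polynomial.coeff_C_zero, Polynomial.coeff_C_succ, Polynomial.coeff_X_zero, mul_one, mul_zero, add_zero, sub_zero,
    show (1 : ℕ) ≠ 2 from by decide, show (0 : ℕ) ≠ 2 from by decide, if_false, zero_sub, zero_add, neg_inj] at h1 h0
  exact ⟨h1, h0⟩

/-- **The matrix hypotheses of §3 from RSL_g's habitat clause** `ρ.IsUnramifiedAt v ∧ ρ.HasFrobCharpolyAt v P` with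
`P ↦ X² − C a · X + C q`, `q` odd (in RSL_g: `a = ι(a_ℓ(g))`, `q = ℓ = natGenerator v`): for every `φ ∈ Γ_{ℚ_v}` with `IsFrobPow φ 1` and every
uniformiser `ϖ`: `det ρ(res_v φ) − 1 ∈ (ϖ)`, `‖tr‖ = ‖a‖`, hence `tr ρ(res_v φ) ∈ (ϖ) ↔ ‖a‖ < 1`. [cite: SerreAbelianLadic1968, Ch. I §2.1]
[cite: NeukirchANT1999, Ch. II (4.8)] -/
theorem det_sub_one_mem_and_trace_mem_iff {P : Polynomial (padicCoeffIntegers S)} (hP : FramedGaloisRep.HasFrobCharpolyAt v P ρ) {a : PadicAlgCl 2}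
    {q : ℕ} (hq : Odd q) (hPmap : P.map (padicCoeffIntegers S).subtype = Polynomial.X ^ 2 - Polynomial.C a * Polynomial.X + Polynomial.C (q : PadicAlgCl 2))
    {φ : absoluteGaloisGroup (v.adicCompletion ℚ)} (hφ : IsFrobPow φ 1) {ϖ : padicCoeffIntegers S} (hϖ : Irreducible ϖ) :
    ((ρ (absGaloisRestrict ℚ (v.adicCompletion ℚ) φ) : GL (Fin 2) (padicCoeffIntegers S)) : Matrix (Fin 2) (Fin 2) (padicCoeffIntegers S)).det - 1 ∈ Ideal.span {ϖ} ∧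
      (((ρ (absGaloisRestrict ℚ (v.adicCompletion ℚ) φ) : GL (Fin 2) (padicCoeffIntegers S)) : Matrix (Fin 2) (Fin 2) (padicCoeffIntegers S)).trace ∈ Ideal.span {ϖ} ↔
        ‖a‖ < 1) := by
  set M : Matrix (Fin 2) (Fin 2) (padicCoeffIntegers S) := ((ρ (absGaloisRestrict ℚ (v.adicCompletion ℚ) φ) : GL (Fin 2) (padicCoeffIntegers S)) :
    Matrix (Fin 2) (Fin 2) (padicCoeffIntegers S)) with hM
  have hchar : M.charpoly.map (padicCoeffIntegers S).subtype = Polynomial.X ^ 2 - Polynomial.C a * Polynomial.X + Polynomial.C (q : PadicAlgCl 2) := by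
    rw [← hPmap, ← charpoly_apply_absGaloisRestrict_eq S ρ hP hφ]
    rfl
  obtain ⟨htr, hdet⟩ := trace_det_of_charpoly_map_eq S M hchar
  obtain ⟨h2, -⟩ := exists_two_mem_span_and_pow_smul_eq_zero S hϖ
  refine ⟨?_, ⟨fun h ↦ htr ▸ norm_coe_lt_one_of_mem_span S hϖ h, fun h ↦ mem_span_of_norm_lt_one' S hϖ (by rwa [htr])⟩⟩
  have hdet' : M.det = (q : padicCoeffIntegers S) := Subtype.ext (by rw [hdet]; norm_cast)
  obtain ⟨j, hj⟩ := hq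
  rw [hdet', hj]
  push_cast
  rw [show (2 * (j : padicCoeffIntegers S) + 1 - 1 : padicCoeffIntegers S) = 2 * j by ring]
  exact Ideal.mul_mem_right _ _ h2

/-- **RSL_g currency, EVEN trace: `#H¹(ℚ_{∞,w}, A_ρ)[2^k] = #A_ρ[2^k]`** at a place `v ∤ 2` not split completely in `κ`, with `ρ.IsUnramifiedAt v`,
`ρ.HasFrobCharpolyAt v P`, `P ↦ X² − aX + q` (`q` odd) and `‖a‖ < 1`. [cite: GreenbergVatsal2000, §2 Prop. (2.4)] [cite: GreenbergLNM1716, §3 Lemma 3.3] -/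
theorem natCard_torsionBy_subgroupH1_cofree_eq_of_norm_lt_one (h2v : ((2 : ℕ) : 𝓞 ℚ) ∉ v.asIdeal)
    (hns : ∃ σ : absoluteGaloisGroup (v.adicCompletion ℚ), σ ∉ localSubgroup κ.kerSubgroup (v.adicCompletion ℚ))
    (hur : FramedGaloisRep.IsUnramifiedAt v ρ) {P : Polynomial (padicCoeffIntegers S)} (hP : FramedGaloisRep.HasFrobCharpolyAt v P ρ) {a : PadicAlgCl 2}
    {q : ℕ} (hq : Odd q) (hPmap : P.map (padicCoeffIntegers S).subtype = Polynomial.X ^ 2 - Polynomial.C a * Polynomial.X + Polynomial.C (q : PadicAlgCl 2))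
    {ϖ : padicCoeffIntegers S} (hϖ : Irreducible ϖ) (ha : ‖a‖ < 1) (k : ℕ) :
    Nat.card (AddSubgroup.torsionBy (subgroupH1 (localSubgroup κ.kerSubgroup (v.adicCompletion ℚ)) (Cofree (ρ.toLocal v) (padicCoeffField S)))
        ((2 ^ k : ℕ) : ℤ)) =
      Nat.card (AddSubgroup.torsionBy (Cofree (ρ.toLocal v) (padicCoeffField S)) ((2 ^ k : ℕ) : ℤ)) := by
  obtain ⟨φ, hφ⟩ := exists_isFrobPow_holds (F := v.adicCompletion ℚ) 1
  obtain ⟨hdet, htr⟩ := det_sub_one_mem_and_trace_mem_iff S ρ hP hq hPmap hφ hϖ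
  exact natCard_torsionBy_subgroupH1_cofree_eq_of_trace_mem S ρ κ h2v hns hφ (fun σ hσ ↦ apply_absGaloisRestrict_eq_one_of_isUnramifiedAt S ρ hur hσ)
    hϖ hdet (htr.mpr ha) k

/-- **RSL_g currency, ODD trace: `H¹(ℚ_{∞,w}, A_ρ) = 0`** at a place `v ∤ 2` not split completely in `κ`, with `ρ.IsUnramifiedAt v`,
`ρ.HasFrobCharpolyAt v P`, `P ↦ X² − aX + q` (`q` odd) and `¬ ‖a‖ < 1`. [cite: GreenbergVatsal2000, §2 Prop. (2.4)] [cite: GreenbergLNM1716, §3 Lemma 3.3] -/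
theorem subgroupH1_cofree_eq_zero_of_not_norm_lt_one (h2v : ((2 : ℕ) : 𝓞 ℚ) ∉ v.asIdeal)
    (hns : ∃ σ : absoluteGaloisGroup (v.adicCompletion ℚ), σ ∉ localSubgroup κ.kerSubgroup (v.adicCompletion ℚ))
    (hur : FramedGaloisRep.IsUnramifiedAt v ρ) {P : Polynomial (padicCoeffIntegers S)} (hP : FramedGaloisRep.HasFrobCharpolyAt v P ρ) {a : PadicAlgCl 2}
    {q : ℕ} (hq : Odd q) (hPmap : P.map (padicCoeffIntegers S).subtype = Polynomial.X ^ 2 - Polynomial.C a * Polynomial.X + Polynomial.C (q : PadicAlgCl 2))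
    {ϖ : padicCoeffIntegers S} (hϖ : Irreducible ϖ) (ha : ¬ ‖a‖ < 1)
    (c : subgroupH1 (localSubgroup κ.kerSubgroup (v.adicCompletion ℚ)) (Cofree (ρ.toLocal v) (padicCoeffField S))) : c = 0 := by
  obtain ⟨φ, hφ⟩ := exists_isFrobPow_holds (F := v.adicCompletion ℚ) 1
  obtain ⟨hdet, htr⟩ := det_sub_one_mem_and_trace_mem_iff S ρ hP hq hPmap hφ hϖ
  exact subgroupH1_cofree_eq_zero_of_trace_not_mem S ρ κ h2v hns hφ (fun σ hσ ↦ apply_absGaloisRestrict_eq_one_of_isUnramifiedAt S ρ hur hσ)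
    hϖ hdet (fun h ↦ ha (htr.mp h)) c

end Frobenius

/-! ## §5 The `ℤ₂`-corank of the block: `2f` at EVEN trace, `0` at ODD trace — `λ_{ℤ₂}(D_w⋆) = f · (if ‖a‖ < 1 then 2 else 0)` -/

section Corank

/-- `#A[p] = p^{corank_{ℤ_p} A}` for a `p`-primary, `p`-DIVISIBLE abelian group with finite `p`-torsion (`A/pA = 0` in the tree's
`pow_zpCorank_mul_natCard_modN`; same statement as X2's `natCard_torsionBy_eq_pow_zpCorank_of_divisible`, restated to keep imports local).
[cite: Greenberg1999, §1] -/
theorem natCard_torsionBy_eq_pow_zpCorank_of_divisible' {A : Type*} [AddCommGroup A] (p : ℕ) [Fact p.Prime]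
    (hA : ∀ a : A, ∃ n : ℕ, p ^ n • a = 0) [Finite (AddSubgroup.torsionBy A (p : ℤ))] (hdiv : ∀ a : A, ∃ b : A, p • b = a) :
    Nat.card (AddSubgroup.torsionBy A (p : ℤ)) = p ^ zpCorank A p := by
  have h := pow_zpCorank_mul_natCard_modN (p := p) hA
  haveI : Subsingleton (ModN A p) := by
    refine ⟨fun x y ↦ ?_⟩
    obtain ⟨a, rfl⟩ := Submodule.mkQ_surjective _ x
    obtain ⟨b, rfl⟩ := Submodule.mkQ_surjective _ y
    rw [← sub_eq_zero, ← map_sub, Submodule.mkQ_apply, Submodule.Quotient.mk_eq_zero]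
    obtain ⟨c, hc⟩ := hdiv (a - b)
    exact ⟨c, by rw [LinearMap.lsmul_apply, natCast_zsmul, hc]⟩
  rw [Nat.card_of_subsingleton (0 : ModN A p), mul_one] at h
  exact h.symm

variable (S : Set (PadicAlgCl 2)) [FiniteDimensional ℚ_[2] (padicCoeffField S)]
  (ρ : FramedGaloisRep ℚ (padicCoeffIntegers S) 2) (κ : ZpExtension ℚ 2) {v : HeightOneSpectrum (𝓞 ℚ)}

/-- **`corank_{ℤ₂} H¹(ℚ_{∞,w}, A_ρ) = f · (if ‖a‖ < 1 then 2 else 0)`** along an additive basis `B : ℤ₂^f ≃+ 𝒪` (RSL_g's pin `f`): the block is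
`2`-primary and `2`-divisible with `#[2] = #(𝒪/2)² = 2^{2f}` at even trace (`natCard_quotient_span_natCast_of_addEquiv`, `natCard_padicInt_quotient_span`)
and is `0` (so `#[2] = 1`) at odd trace — the per-block value of the `S₀`-count `f·Σ ≤ λ_{ℤ₂}(P_{S₀})`; `λ_{ℤ₂}` of the Pontryagin dual equals this
corank by the tree's `finrank_eq_zpCorank_of_addEquiv_characterModule`. [cite: GreenbergVatsal2000, §1 p. 7, §2 Prop. (2.4)] [cite: Greenberg1999, §1] -/
theorem zpCorank_subgroupH1_cofree_eq (h2v : ((2 : ℕ) : 𝓞 ℚ) ∉ v.asIdeal)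
    (hns : ∃ σ : absoluteGaloisGroup (v.adicCompletion ℚ), σ ∉ localSubgroup κ.kerSubgroup (v.adicCompletion ℚ))
    (hur : FramedGaloisRep.IsUnramifiedAt v ρ) {P : Polynomial (padicCoeffIntegers S)} (hP : FramedGaloisRep.HasFrobCharpolyAt v P ρ) {a : PadicAlgCl 2}
    {q : ℕ} (hq : Odd q) (hPmap : P.map (padicCoeffIntegers S).subtype = Polynomial.X ^ 2 - Polynomial.C a * Polynomial.X + Polynomial.C (q : PadicAlgCl 2))
    {ϖ : padicCoeffIntegers S} (hϖ : Irreducible ϖ) {f : ℕ} (B : (Fin f → ℤ_[2]) ≃+ padicCoeffIntegers S) :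
    zpCorank (subgroupH1 (localSubgroup κ.kerSubgroup (v.adicCompletion ℚ)) (Cofree (ρ.toLocal v) (padicCoeffField S))) 2 =
      f * (if ‖a‖ < 1 then 2 else 0) := by
  have hA : ∀ c : subgroupH1 (localSubgroup κ.kerSubgroup (v.adicCompletion ℚ)) (Cofree (ρ.toLocal v) (padicCoeffField S)), ∃ k : ℕ, 2 ^ k • c = 0 :=
    exists_pow_nsmul_eq_zero κ (exists_pow_smul_cofree_eq_zero S (ρ.toLocal v))
  have hdiv := exists_two_nsmul_eq_subgroupH1_cofree S ρ κ h2v hns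
  by_cases ha : ‖a‖ < 1
  · rw [if_pos ha]
    have h1 := natCard_torsionBy_subgroupH1_cofree_eq_of_norm_lt_one S ρ κ h2v hns hur hP hq hPmap hϖ ha 1
    have hcof : Nat.card (AddSubgroup.torsionBy (Cofree (ρ.toLocal v) (padicCoeffField S)) ((2 ^ 1 : ℕ) : ℤ)) =
        Nat.card (padicCoeffIntegers S ⧸ Ideal.span {(2 : padicCoeffIntegers S) ^ 1}) ^ 2 :=
      Summit.BirchSwinnertonDyer.BirchSwinnertonDyer.Theorems.ThetaTransport.CofreeTorsionCount.natCard_torsionBy_cofree S ρ 1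
    rw [hcof, pow_one, pow_one, show ((2 : padicCoeffIntegers S)) = ((2 : ℕ) : padicCoeffIntegers S) by norm_cast,
      Summit.BirchSwinnertonDyer.BirchSwinnertonDyer.Theorems.ThetaTransport.CofreeTorsionCount.natCard_quotient_span_natCast_of_addEquiv 2 B,
      Summit.BirchSwinnertonDyer.BirchSwinnertonDyer.Theorems.SignedTransportAtTwo.natCard_padicInt_quotient_span 2, ← pow_mul] at h1
    haveI : Finite (AddSubgroup.torsionBy (subgroupH1 (localSubgroup κ.kerSubgroup (v.adicCompletion ℚ)) (Cofree (ρ.toLocal v) (padicCoeffField S)))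
        ((2 : ℕ) : ℤ)) := Nat.finite_of_card_ne_zero (by rw [h1]; positivity)
    have h2 := natCard_torsionBy_eq_pow_zpCorank_of_divisible' 2 hA hdiv
    rw [h1] at h2
    have := Nat.pow_right_injective (le_refl 2) h2
    omega
  · rw [if_neg ha, mul_zero]
    haveI : Subsingleton (subgroupH1 (localSubgroup κ.kerSubgroup (v.adicCompletion ℚ)) (Cofree (ρ.toLocal v) (padicCoeffField S))) :=
      ⟨fun x y ↦ by rw [subgroupH1_cofree_eq_zero_of_not_norm_lt_one S ρ κ h2v hns hur hP hq hPmap hϖ ha x,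
        subgroupH1_cofree_eq_zero_of_not_norm_lt_one S ρ κ h2v hns hur hP hq hPmap hϖ ha y]⟩
    have h2 := natCard_torsionBy_eq_pow_zpCorank_of_divisible' 2 hA hdiv
    rw [Nat.card_of_subsingleton (0 : AddSubgroup.torsionBy _ ((2 : ℕ) : ℤ))] at h2
    exact (Nat.pow_eq_one.mp h2.symm).resolve_left (by norm_num)

end Corank

end Summit.BirchSwinnertonDyer.BirchSwinnertonDyer.Theorems.ThetaTransport.LocalBlockCount

end
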